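import Literature.RingTheory.Flat.HopfIdealSpecialFibre                    -- ★ p845336 (A-p14): `sp` plumbing, `isHopfIdeal_map_includeRight` (brings ★ G2c∕G2d)
import Literature.AlgebraicGeometry.Morphisms.ClosedImmersionOfEqualRank   -- ★ 02KA algebra: `bijective_of_surjective_of_finrank_eq_of_finite_flat`
import HarnessLib

/-!
# The canonical line is the generic fibre of the unit component — Hopf-ideal currency (Serre–Tate 1968 §1; Tate (3.7); Katz 1973 §3.1)

Topic `Literature/RingTheory/Flat`; namespace `Literature.RingTheory.Flat`.  THEOREMS ONLY (no definition, no instance, no notation, no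
named fact, no `sorry`).  Cell `hodgecm-mathlib` (D-0151), programme P6 «MOD», DICT brick **(D4) = (b4′-U)** of F0P6c-plan (g2) (2026-09-01
17:01Z), the ED.-4 glue `hKb4` typed ONCE: in the (ii) currency of ★ `HopfIdealSpecialFibre` (`K = Frac R`, `κ` the residue field, `A` a
module-finite commutative Hopf algebra over the valuation ring `R`, closure `J ∩ A := J.comap includeRight`, special fibre
`sp J := (J ∩ A)·(κ ⊗ A)`), the UNIT COMPONENT is an ideal `I₀ = (1 − e) ⊂ A` cut out by an idempotent (open-and-closed) with `A ⧸ I₀` free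
of rank `r`, its generic fibre is `J₀ := I₀·(K ⊗ A)`, and:

* §1 **(L1)(L2)** `J₀` is a Hopf ideal of corank `r`, stable under every endomorphism stabilising `I₀`, with closure `J₀ ∩ A = I₀` (so
  `sp J₀ = I₀·(κ ⊗ A)`, the unit component of the special fibre) — ★ `isHopfIdeal_map_includeRight`, ★ G2d
  `finrank_quotient_map_includeRight_of_free`, ★ G2c `eq_comap_includeRight_of_flat_of_map_eq`;
* §2 **(L3) UNIQUENESS `comap_includeRight_eq_of_le_sup_maximalIdeal`**: a Hopf ideal `J ⊂ K ⊗ A` of corank `r` whose closure satisfies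
  `I₀ ≤ (J ∩ A) + 𝔪_R A` («the special fibre of the closure lies in the unit component», one inclusion of `sp J = sp J₀`) HAS closure
  `J ∩ A = I₀`, hence `J = J₀` — the closure `I := J ∩ A` is a Hopf ideal with `A ⧸ I` FREE of rank `r` (★ G2d), the idempotent
  `f := 1 − ē ∈ A ⧸ I` lies in `𝔪_R·(A ⧸ I) ⊆ Jac (A ⧸ I)` (Mathlib `maximalIdeal_le_jacobson`, module-finite over local `R`), so `f = 0`,
  i.e. `I₀ ≤ I`; equal rank + flatness then force `I = I₀` (★ `bijective_of_surjective_of_finrank_eq_of_finite_flat`), and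
  `J = (J ∩ A)·(K ⊗ A) = J₀` (★ G2c `map_comap_includeRight`);
* §3 **(L4) packaged closer `existsUnique_hopfIdeal_closure_le_sup`** for DICT's `hKb4`.

Count-neutral Mathlib-side capital: HC_CM is proved only modulo the printed citations until rung 0 closes; nothing here bears on it.

## References
* [SerreTate1968] J.-P. Serre, J. Tate, *Good reduction of abelian varieties*, Ann. of Math. 88 (1968) — §1 Lemma 1.
* [Tate1997FiniteFlatGroupSchemes] J. Tate, *Finite flat group schemes* (1997) — (3.7) (unit component over a henselian base; `G⁰(R)`).
* [Katz1973] N. M. Katz, *p-adic properties of modular schemes and modular forms*, LNM 350 (1973) — §3.1 («canonical subgroup»).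
* [EGAIV2] A. Grothendieck, *EGA IV₂* — Prop. 2.8.5 (schematic closure over a valuation ring ∕ flat closure).
-/

set_option autoImplicit false

namespace Literature.RingTheory.Flat

open TensorProduct Algebra.TensorProduct IsLocalRing

universe u

variable {R A K : Type*} [CommRing R] [CommRing A] [HopfAlgebra R A] [CommRing K] [Algebra R K]

/-! ## §1 (L1)(L2) The generic fibre of the unit component: Hopf, corank `r`, closure `= I₀` -/

section Generic

variable (I₀ : Ideal A)

/-- **(L1) The generic fibre `J₀ = I₀·(K ⊗ A)` of a Hopf ideal `I₀` with free quotient is a Hopf ideal of the same corank**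
(★ `isHopfIdeal_map_includeRight`, ★ G2d `finrank_quotient_map_includeRight_of_free`). [cite: EGAIV2, Prop. 2.8.5] [cite: Tate1997FiniteFlatGroupSchemes, (3.7)] -/
theorem isHopfIdeal_and_finrank_map_includeRight [Nontrivial R] [Nontrivial K] [I₀.IsHopfIdeal R] [Module.Free R (A ⧸ I₀)] :
    (I₀.map (includeRight : A →ₐ[R] K ⊗[R] A)).IsHopfIdeal K ∧
      Module.finrank K ((K ⊗[R] A) ⧸ I₀.map (includeRight : A →ₐ[R] K ⊗[R] A)) = Module.finrank R (A ⧸ I₀) :=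
  ⟨isHopfIdeal_map_includeRight (S := K) I₀, finrank_quotient_map_includeRight_of_free (R := R) (K := K) I₀⟩

/-- (L1, stability) `J₀` is stable under `1 ⊗ b` for every endomorphism `b` stabilising `I₀` (★ `map_map_includeRight_le_of_map_le`).
[cite: Tate1997FiniteFlatGroupSchemes, (3.7)] -/
theorem map_map_includeRight_le (b : A →ₐ[R] A) (hb : I₀.map b ≤ I₀) :
    (I₀.map (includeRight : A →ₐ[R] K ⊗[R] A)).map (Algebra.TensorProduct.map (AlgHom.id K K) b) ≤
      I₀.map (includeRight : A →ₐ[R] K ⊗[R] A) :=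
  map_map_includeRight_le_of_map_le b I₀ hb

/-- **(L2) The closure of the generic fibre of the unit component is the unit component**: `J₀ ∩ A = I₀` (flat quotient ⇒ saturated,
★ G2c `eq_comap_includeRight_of_flat_of_map_eq`); consequently `sp J₀ = I₀·(κ ⊗ A)` for every `R`-algebra `κ`.
[cite: EGAIV2, Prop. 2.8.5] -/
theorem comap_map_includeRight_eq [IsLocalization (nonZeroDivisors R) K] [Module.Flat R (A ⧸ I₀)] :
    (I₀.map (includeRight : A →ₐ[R] K ⊗[R] A)).comap (includeRight : A →ₐ[R] K ⊗[R] A) = I₀ :=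
  (eq_comap_includeRight_of_flat_of_map_eq (R := R) (K := K) _ I₀ rfl).symm

end Generic

/-! ## §2 (L3) Uniqueness: a corank-`r` generic Hopf ideal whose closure specialises into the unit component IS `J₀` -/

section Unique

variable [IsDomain R] [ValuationRing R] [Module.Finite R A] [Nontrivial K] [IsLocalization (nonZeroDivisors R) K]

/-- An idempotent of a module-finite algebra over a local ring lying in `𝔪_R · B` is `0` (`𝔪_R B ⊆ Jac B`: every maximal ideal
of `B` contracts to `𝔪_R`; then Nakayama's `isUnit_of_sub_one_mem_jacobson_bot`). [cite: Tate1997FiniteFlatGroupSchemes, (3.7)] -/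
theorem isIdempotentElem_eq_zero_of_mem_map_maximalIdeal {B : Type*} [CommRing B] [Algebra R B] [Module.Finite R B] {f : B}
    (hf : IsIdempotentElem f) (hfm : f ∈ (maximalIdeal R).map (algebraMap R B)) : f = 0 := by
  have hjac : f ∈ (⊥ : Ideal B).jacobson := by
    rw [Ideal.jacobson, Ideal.mem_sInf]
    rintro M ⟨-, hM⟩
    haveI : M.IsMaximal := hM
    have hcomap : M.comap (algebraMap R B) = maximalIdeal R :=
      IsLocalRing.eq_maximalIdeal (Ideal.isMaximal_comap_of_isIntegral_of_isMaximal M)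
    exact (Ideal.map_le_iff_le_comap.mpr hcomap.ge) hfm
  have hunit : IsUnit (1 - f) :=
    Ideal.isUnit_of_sub_one_mem_jacobson_bot _ (by rw [sub_sub_cancel_left]; exact ((⊥ : Ideal B).jacobson).neg_mem hjac)
  have h0 : f * (1 - f) = 0 := by rw [mul_sub, mul_one, hf.eq, sub_self]
  exact hunit.mul_left_eq_zero.mp h0

/-- **(L3) UNIQUENESS OF THE CANONICAL LINE.**  `R` a valuation ring with fraction field `K`, `A` a module-finite commutative Hopf
`R`-algebra, `I₀ = (1 − e)` the ideal of an open-and-closed subscheme (`e` idempotent) with `A ⧸ I₀` free (the UNIT COMPONENT, rank `r`).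
If a Hopf ideal `J` of the generic fibre `K ⊗ A` has corank `r` and its closure specialises INTO the unit component —
`I₀ ≤ (J ∩ A) + 𝔪_R A`, i.e. `sp J₀ ≤ sp J` — then `J ∩ A = I₀` and `J = J₀ := I₀·(K ⊗ A)`: «the only line specialising to `ker F` is the
canonical one». [cite: SerreTate1968, §1 Lemma 1] [cite: Katz1973, §3.1] [cite: EGAIV2, Prop. 2.8.5] -/
theorem comap_includeRight_eq_of_le_sup_maximalIdeal {e : A} (he : IsIdempotentElem e) (I₀ : Ideal A) (hI₀ : I₀ = Ideal.span {1 - e})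
    [Module.Free R (A ⧸ I₀)] (J : Ideal (K ⊗[R] A)) [J.IsHopfIdeal K]
    (hr : Module.finrank K ((K ⊗[R] A) ⧸ J) = Module.finrank R (A ⧸ I₀))
    (hsp : I₀ ≤ J.comap (includeRight : A →ₐ[R] K ⊗[R] A) ⊔ (maximalIdeal R).map (algebraMap R A)) :
    J.comap (includeRight : A →ₐ[R] K ⊗[R] A) = I₀ ∧ J = I₀.map (includeRight : A →ₐ[R] K ⊗[R] A) := by
  set I := J.comap (includeRight : A →ₐ[R] K ⊗[R] A) with hI
  obtain ⟨-, hfree, hrank, hmap⟩ := isHopfIdeal_free_finrank_closure_of_valuationRing (K := K) J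
  haveI := hfree
  haveI : Module.Finite R (A ⧸ I) := Module.Finite.of_surjective (Ideal.Quotient.mkₐ R I).toLinearMap Ideal.Quotient.mk_surjective
  haveI : Module.Finite R (A ⧸ I₀) := Module.Finite.of_surjective (Ideal.Quotient.mkₐ R I₀).toLinearMap Ideal.Quotient.mk_surjective
  -- (1) `1 - e ∈ I`: its class in `A ⧸ I` is an idempotent inside `𝔪_R (A ⧸ I)`, hence `0`
  have hmem : (1 : A) - e ∈ I := by
    have h1e : (1 : A) - e ∈ I₀ := by rw [hI₀]; exact Ideal.mem_span_singleton_self _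
    obtain ⟨y, hy, z, hz, hyz⟩ := Submodule.mem_sup.mp (hsp h1e)
    have hf : IsIdempotentElem (Ideal.Quotient.mk I (1 - e)) := he.one_sub.map (Ideal.Quotient.mk I)
    have hfm : Ideal.Quotient.mk I (1 - e) ∈ (maximalIdeal R).map (algebraMap R (A ⧸ I)) := by
      have hze : Ideal.Quotient.mk I (1 - e) = Ideal.Quotient.mk I z := by
        rw [← hyz, map_add, Ideal.Quotient.eq_zero_iff_mem.mpr hy, zero_add]
      rw [hze, show algebraMap R (A ⧸ I) = (Ideal.Quotient.mk I).comp (algebraMap R A) from rfl, ← Ideal.map_map]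
      exact Ideal.mem_map_of_mem _ hz
    exact Ideal.Quotient.eq_zero_iff_mem.mp (isIdempotentElem_eq_zero_of_mem_map_maximalIdeal (R := R) hf hfm)
  have hle : I₀ ≤ I := by
    rw [hI₀, Ideal.span_le, Set.singleton_subset_iff]
    exact hmem
  -- (2) equal rank + flatness: the surjection `A ⧸ I₀ → A ⧸ I` is bijective, so `I = I₀`
  have hsurj : Function.Surjective (Ideal.Quotient.factorₐ R hle) := fun x => by
    obtain ⟨a, rfl⟩ := Ideal.Quotient.mk_surjective x
    exact ⟨Ideal.Quotient.mk I₀ a, rfl⟩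
  have hbij := Literature.AlgebraicGeometry.Morphisms.bijective_of_surjective_of_finrank_eq_of_finite_flat
    (Ideal.Quotient.factorₐ R hle).toLinearMap hsurj (by rw [hrank, hr])
  have hEq : I = I₀ := by
    refine le_antisymm (fun a ha => ?_) hle
    have h0 : (Ideal.Quotient.factorₐ R hle).toLinearMap (Ideal.Quotient.mk I₀ a) = 0 := by
      change Ideal.Quotient.mk I a = 0
      exact Ideal.Quotient.eq_zero_iff_mem.mpr ha
    exact Ideal.Quotient.eq_zero_iff_mem.mp (hbij.1 (h0.trans (map_zero _).symm))
  refine ⟨hEq, ?_⟩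
  rw [← hEq]
  exact hmap.symm

/-- **(L4) PACKAGED CLOSER for DICT's `hKb4`**: under the hypotheses of (L3) there is EXACTLY ONE Hopf ideal of `K ⊗ A` of corank `r`
whose closure specialises into the unit component, namely `J₀ = I₀·(K ⊗ A)` — existence by §1, uniqueness by (L3).
[cite: SerreTate1968, §1 Lemma 1] [cite: Katz1973, §3.1] -/
theorem existsUnique_hopfIdeal_closure_le_sup {e : A} (he : IsIdempotentElem e) (I₀ : Ideal A) (hI₀ : I₀ = Ideal.span {1 - e})
    [I₀.IsHopfIdeal R] [Module.Free R (A ⧸ I₀)] :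
    ∃! J : Ideal (K ⊗[R] A), J.IsHopfIdeal K ∧ Module.finrank K ((K ⊗[R] A) ⧸ J) = Module.finrank R (A ⧸ I₀) ∧
      I₀ ≤ J.comap (includeRight : A →ₐ[R] K ⊗[R] A) ⊔ (maximalIdeal R).map (algebraMap R A) := by
  refine ⟨I₀.map (includeRight : A →ₐ[R] K ⊗[R] A), ⟨isHopfIdeal_map_includeRight (S := K) I₀,
    finrank_quotient_map_includeRight_of_free (R := R) (K := K) I₀, ?_⟩, ?_⟩
  · rw [comap_map_includeRight_eq (K := K) I₀]
    exact le_sup_left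
  · rintro J ⟨hJ, hr, hsp⟩
    haveI := hJ
    exact (comap_includeRight_eq_of_le_sup_maximalIdeal (K := K) he I₀ hI₀ J hr hsp).2

end Unique

end Literature.RingTheory.Flat
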